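import Summits.CriticalPhenomena.CardyFormulaZ2.Theorems.CardyWickAnisotropyBoxFamilyToCardyTightness
import HarnessLib

/-!
# Split glue for crux `BoxFamilyToCardy` (stmt-CriticalPhenomena-14215, route `CardyWickAnisotropy`)

Crux-strategist seat `cstrat-stmt-CriticalPhenomena-14215-s1`. The crux `BoxFamilyToCardy :
AnisotropicBoxCardy → CardyFormulaZ2` ("Cardy along the anisotropic self-dual box family of bond-`ℤ²`
implies Cardy's formula for every conformal rectangle") is, modulo the printed DKKMO 2020 Thm. 2.1
(`DKKMO2020_thm21_schrammSmirnov`, a named fact), kernel-equivalent to `AnisotropicBoxCardy →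
ConfInvTransport` (`boxFamilyToCardy_iff_confInvTransport`, landed by lead c5). This file records, sorry-free
and over existing declarations only, the two typed decompositions offered in `STRATEGY-CENSUS.md`
(§ Decomposition) for `ledger route edit route-CriticalPhenomena-CardyWickAnisotropy --split BoxFamilyToCardy …`:

* **Split (I), structural / dedup (PRIMARY, prepared):** `BoxFamilyToCardy ⇐ BoxFamilyToRectangles ∧
  ConfInvTransport` — `BoxFamilyToRectangles := AnisotropicBoxCardy → RectCardy` (the KNOWN half: closed modulo
  the printed DKKMO Thm. 2.1 by `isotropicRectangles_of_thm21SS`; strictly weaker than the crux) and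
  `ConfInvTransport` = stmt-CriticalPhenomena-0794 VERBATIM (conformal invariance of bond-`ℤ²` crossing limits in
  transport form; the open half; dedups by signature so the route joins 0794's `wanted_by` instead of double-staffing
  it). Glue `BoxFamilyToCardy_of_subs` (seam = `cardyFormulaZ2_of_confInvTransport_of_rectCardy`, i.e.
  `exists_rect_datum_of_mem_Ioo` + transport; non-trivial but landed). Tightness: given the printed fact and
  `AnisotropicBoxCardy`, piece 2 is NECESSARY (`split_I_tight`) — it remains the whole crux; the split is honest
  bookkeeping, not leverage.
* **Split (II), existence ∣ rigidity (bridge shape, NOT fileable — no plan for either side):**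
  `BoxFamilyToCardy ⇐ BoxFamilyToRectangles ∧ QuadLimitsExist ∧ ValuesFromExistence`, separating EXISTENCE of every
  single-quad crossing limit of bond-`ℤ²` (no values; a consequence of the conjunct, `quadLimitsExist_of_cardyFormulaZ2`)
  from CONFORMAL RIGIDITY GIVEN EXISTENCE and the rectangle values. Recorded so that the census' claim "existence is not
  a foothold for the transport step" is a statement about typed objects.

Nothing here is new mathematics: every theorem is a composition of landed theorems. [folklore]
-/

namespace Summit.CriticalPhenomena.CardyFormulaZ2.Cruxes.BoxFamilyToCardy.Split

open Filter Topology Set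
open Literature.Probability.RandomPlanarGeometry
open Literature.Probability.Percolation (bondDomainCrossingProb DKKMO2020_thm21_schrammSmirnov)
open Summit.CriticalPhenomena.CardyFormulaZ2.Theses.CardyWickAnisotropy (AnisotropicBoxCardy BoxFamilyToCardy)
open Summit.CriticalPhenomena.CardyFormulaZ2.Theses.CardyMonotoneApproach (RectCardy ConfInvTransport)
open Summit.CriticalPhenomena.CardyFormulaZ2.Cruxes.BoxFamilyToCardy.Birth

/-! ## Split (I): known half ∣ conformal transport (= stmt-0794) -/

/-- **Child 1 of split (I) — the KNOWN half.** Cardy along the anisotropic self-dual box family gives Cardy's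
formula for every corner-marked axis-parallel rectangle of isotropic bond-`ℤ²` at `p = 1/2`
(`AnisotropicBoxCardy → RectCardy`, the body of `RectCardy` = stmt-CriticalPhenomena-5843 inlined verbatim).
Closed modulo the printed DKKMO 2020 Thm. 2.1 (`boxFamilyToRectangles_of_thm21SS`). [cite: DKKMO2020Rotational, Thm. 2.1 (q = 1)] -/
def BoxFamilyToRectangles : Prop :=
  AnisotropicBoxCardy → (∀ (R : Literature.Probability.RandomPlanarGeometry.ConformalRectangle) (w h : ℝ), 0 < w → 0 < h → R.carrier = Set.Ioo (0:ℝ) w ×ℂ Set.Ioo (0:ℝ) h → (R.pt 0 = (h:ℂ) * Complex.I ∧ R.pt 1 = 0 ∧ R.pt 2 = (w:ℂ) ∧ R.pt 3 = (w:ℂ) + (h:ℂ) * Complex.I) → R.HasCrossingLimit (Literature.Probability.Percolation.bondDomainCrossingProb R) Literature.Probability.RandomPlanarGeometry.cardyFunction)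

/-- Child 1 is by definition `AnisotropicBoxCardy → RectCardy`. [folklore] -/
theorem boxFamilyToRectangles_iff : BoxFamilyToRectangles ↔ (AnisotropicBoxCardy → RectCardy) := Iff.rfl

/-- **Child 2 of split (I)** is `ConfInvTransport` (stmt-CriticalPhenomena-0794) itself; restated here only to
certify that the verbatim body used in `children-I.json` is definitionally that item. [folklore] -/
theorem confInvTransport_body_iff :
    (∀ (R R' : Literature.Probability.RandomPlanarGeometry.ConformalRectangle) (φ : Literature.Probability.RandomPlanarGeometry.ConformalEquiv UpperHalfPlane.upperHalfPlaneSet R.carrier) (x : Fin 4 → ℝ) (φ' : Literature.Probability.RandomPlanarGeometry.ConformalEquiv UpperHalfPlane.upperHalfPlaneSet R'.carrier) (x' : Fin 4 → ℝ), R.IsUniformizing φ x → R'.IsUniformizing φ' x' → Literature.Probability.RandomPlanarGeometry.crossRatio x = Literature.Probability.RandomPlanarGeometry.crossRatio x' → ∀ L : ℝ, Filter.Tendsto (Literature.Probability.Percolation.bondDomainCrossingProb R) (nhdsWithin 0 (Set.Ioi 0)) (nhds L) → Filter.Tendsto (Literature.Probability.Percolation.bondDomainCrossingProb R') (nhdsWithin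 0 (Set.Ioi 0)) (nhds L)) ↔ ConfInvTransport := Iff.rfl

/-- **Split (I) glue — `BoxFamilyToCardy_of_subs : BoxFamilyToRectangles → ConfInvTransport → BoxFamilyToCardy`.**
Given `AnisotropicBoxCardy`, child 1 gives Cardy on corner-marked rectangles; realise any cross-ratio as a
rectangle modulus and transport the limit (`cardyFormulaZ2_of_confInvTransport_of_rectCardy`, landed).
Intended use: `route edit --split BoxFamilyToCardy --into children-I.json --glue-by <this decl>`. [folklore] -/
theorem BoxFamilyToCardy_of_subs : BoxFamilyToRectangles → ConfInvTransport → BoxFamilyToCardy :=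
  fun h1 h2 hA => cardyFormulaZ2_of_confInvTransport_of_rectCardy h2 (h1 hA)

/-- The same glue with both children's bodies inlined verbatim (the form a generated glue ITEM would take). [folklore] -/
theorem BoxFamilyToCardy_of_subs_verbatim :
    (AnisotropicBoxCardy → (∀ (R : Literature.Probability.RandomPlanarGeometry.ConformalRectangle) (w h : ℝ), 0 < w → 0 < h → R.carrier = Set.Ioo (0:ℝ) w ×ℂ Set.Ioo (0:ℝ) h → (R.pt 0 = (h:ℂ) * Complex.I ∧ R.pt 1 = 0 ∧ R.pt 2 = (w:ℂ) ∧ R.pt 3 = (w:ℂ) + (h:ℂ) * Complex.I) → R.HasCrossingLimit (Literature.Probability.Percolation.bondDomainCrossingProb R) Literature.Probability.RandomPlanarGeometry.cardyFunction)) →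
    (∀ (R R' : Literature.Probability.RandomPlanarGeometry.ConformalRectangle) (φ : Literature.Probability.RandomPlanarGeometry.ConformalEquiv UpperHalfPlane.upperHalfPlaneSet R.carrier) (x : Fin 4 → ℝ) (φ' : Literature.Probability.RandomPlanarGeometry.ConformalEquiv UpperHalfPlane.upperHalfPlaneSet R'.carrier) (x' : Fin 4 → ℝ), R.IsUniformizing φ x → R'.IsUniformizing φ' x' → Literature.Probability.RandomPlanarGeometry.crossRatio x = Literature.Probability.RandomPlanarGeometry.crossRatio x' → ∀ L : ℝ, Filter.Tendsto (Literature.Probability.Percolation.bondDomainCrossingProb R) (nhdsWithin 0 (Set.Ioi 0)) (nhds L) → Filter.Tendsto (Literature.Probability.Percolation.bondDomainCrossingProb R') (nhdsWithin 0 (Set.Ioi 0)) (nhds L)) →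
    BoxFamilyToCardy :=
  BoxFamilyToCardy_of_subs

/-- **Child 1 is closed modulo the printed fact** (lead c2's `isotropicRectangles_of_thm21SS`). [cite: DKKMO2020Rotational, Thm. 2.1 (q = 1)] -/
theorem boxFamilyToRectangles_of_thm21SS : DKKMO2020_thm21_schrammSmirnov → BoxFamilyToRectangles :=
  fun h => isotropicRectangles_of_thm21SS h

/-- **Tightness of split (I):** modulo the printed DKKMO Thm. 2.1, the crux is EQUIVALENT to "child 1's hypothesis
gives child 2" — so child 2 (`ConfInvTransport`, open) carries the whole difficulty; the split is bookkeeping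
(dedup with stmt-0794), not leverage. [cite: DKKMO2020Rotational, Thm. 2.1 (q = 1)] -/
theorem split_I_tight (hSS : DKKMO2020_thm21_schrammSmirnov) :
    BoxFamilyToCardy ↔ (AnisotropicBoxCardy → ConfInvTransport) :=
  boxFamilyToCardy_iff_confInvTransport hSS

/-- Piece probe (c), recorded positively: child 2 ALONE gives the crux only THROUGH the printed fact
(`boxFamilyToCardy_of_thm21SS_of_confInvTransport`); without `hSS` no term of type
`ConfInvTransport → BoxFamilyToCardy` is in the tree (see `bc/child_probe.lean`). [cite: DKKMO2020Rotational, Thm. 2.1 (q = 1)] -/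
theorem boxFamilyToCardy_of_confInvTransport_of_thm21SS (hSS : DKKMO2020_thm21_schrammSmirnov) :
    ConfInvTransport → BoxFamilyToCardy :=
  fun h => boxFamilyToCardy_of_thm21SS_of_confInvTransport hSS h

/-! ## Split (II): existence ∣ rigidity-given-existence (recorded, not filed) -/

/-- **Piece A of split (II) — EXISTENCE only.** Every conformal rectangle has SOME limiting bond-`ℤ²` crossing
probability as `δ → 0⁺` (no value asserted). Open (Schramm 2007 ICM, Problem 2.11 asks for existence and conformal
invariance); a consequence of the conjunct (`quadLimitsExist_of_cardyFormulaZ2`). [cite: Schramm2007ICM, Problem 2.11] -/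
def QuadLimitsExist : Prop :=
  ∀ R : Literature.Probability.RandomPlanarGeometry.ConformalRectangle, ∃ L : ℝ,
    Filter.Tendsto (Literature.Probability.Percolation.bondDomainCrossingProb R) (nhdsWithin 0 (Set.Ioi 0)) (nhds L)

/-- **Piece B of split (II) — conformal RIGIDITY given existence and the rectangle values.** If every quad limit
exists and corner-marked rectangles have Cardy's values, then every quad has Cardy's value. As a bare implication
about the actual `ℤ²` model it is true iff the conjunct is; its content for a prover is "existence + similarity
invariance (DKKMO) + rectangle values ⇒ conformal invariance", for which no tool is known (census § Decomposition,
§ Transfer: the Øksendal–Stroock mechanism needs a pointed strong Markov process). [cite: Schramm2007ICM, Problem 2.11] -/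
def ValuesFromExistence : Prop :=
  QuadLimitsExist → (∀ (R : Literature.Probability.RandomPlanarGeometry.ConformalRectangle) (w h : ℝ), 0 < w → 0 < h → R.carrier = Set.Ioo (0:ℝ) w ×ℂ Set.Ioo (0:ℝ) h → (R.pt 0 = (h:ℂ) * Complex.I ∧ R.pt 1 = 0 ∧ R.pt 2 = (w:ℂ) ∧ R.pt 3 = (w:ℂ) + (h:ℂ) * Complex.I) → R.HasCrossingLimit (Literature.Probability.Percolation.bondDomainCrossingProb R) Literature.Probability.RandomPlanarGeometry.cardyFunction) → CardyFormulaZ2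

/-- **Split (II) glue:** `BoxFamilyToRectangles → QuadLimitsExist → ValuesFromExistence → BoxFamilyToCardy` (modus
ponens after the known half; `trivial_seam`). [folklore] -/
theorem BoxFamilyToCardy_of_existence_split :
    BoxFamilyToRectangles → QuadLimitsExist → ValuesFromExistence → BoxFamilyToCardy :=
  fun h1 hE hV hA => hV hE (h1 hA)

/-- Piece A is a consequence of the conjunct (so it is strictly on-path): Cardy's formula gives the limit
`cardyFunction (crossRatio x)` for any uniformizing datum, which exists by Riemann–Carathéodory
(`MarkedDomain.exists_isUniformizing_holds`, proved in the tree). [folklore] -/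
theorem quadLimitsExist_of_cardyFormulaZ2 : CardyFormulaZ2 → QuadLimitsExist := by
  intro hC R
  obtain ⟨φ, x, hφ⟩ := MarkedDomain.exists_isUniformizing_holds R
  exact ⟨_, hC R φ x hφ⟩

/-- Piece B is a consequence of the conjunct too (trivially: its conclusion is the conjunct). [folklore] -/
theorem valuesFromExistence_of_cardyFormulaZ2 : CardyFormulaZ2 → ValuesFromExistence :=
  fun h _ _ => h

end Summit.CriticalPhenomena.CardyFormulaZ2.Cruxes.BoxFamilyToCardy.Split
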